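import Summits.AtomisticToContinuum.BoseEinsteinCondensation.Theses.BECDyadicChaining
import Literature.MathematicalPhysics.QuantumManyBody.FreeDirichletGap
import HarnessLib

/-!
# Route `BECDyadicChaining` — crux `DyadicCoherenceDefect` (stmt-AtomisticToContinuum-13192), stub G `stub_freeDirichletGap`

The FREE DIRICHLET GAP input of the free-gas case (line `registered`, lead c1, wave 2): for
`N ≥ 1`, `L > 0` there is `c = c(N, L) > 0` — here the sharp `3π²/L²` — with
`3Nπ²/L² + c ‖Ψ − ⟨Ψ₀, Ψ⟩Ψ₀‖² ≤ energy 0 Ψ` for every Dirichlet trial state `Ψ ∈ TrialState N L`,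
where `Ψ₀(X) = 1_{Λ^N}(X) ∏ᵢ∏ₖ (2/L)^{1/2} sin(πX_{ik}/L)` is the normalised free ground state.
This is exactly `Literature.MathematicalPhysics.QuantumManyBody.BoseGas.freeDirichletGap`
(`FreeDirichletGap.lean`: flatten `(ℝ³)^N ≅ ℝ^{3N}`, sine-series Parseval on the cube
(`DirichletBoxParseval.lean`), the cube gap `|k|² ≥ 3N + 3` for `k ≠ 𝟙` (`DirichletBoxGap.lean`),
Pythagoras for the projection onto `Ψ₀`). [LSSY2005, Ch. 2, (2.3) and after (2.50)]
-/

noncomputable section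

open Filter MeasureTheory
open scoped ENNReal NNReal BigOperators

namespace Summit.AtomisticToContinuum.BoseEinsteinCondensation.Cruxes.DyadicCoherenceDefect.Birth

open Literature.MathematicalPhysics.QuantumManyBody.BoseGas
open Summit.AtomisticToContinuum.BoseEinsteinCondensation.Theses

/-- **Stub G `stub_freeDirichletGap` (registered signature): the free Dirichlet gap.** For
`N ≥ 1`, `L > 0` there is `c > 0` (`= 3π²/L²`) such that
`3Nπ²/L² + c ∫|Ψ − ⟨Ψ₀,Ψ⟩Ψ₀|² ≤ energy 0 Ψ` for every Dirichlet trial state `Ψ`, `Ψ₀` the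
normalised product of sines. [cite: LSSY2005, Ch. 2, (2.3) and after (2.50)] -/
theorem stub_freeDirichletGap :
    ∀ (N : ℕ) (L : ℝ), 1 ≤ N → 0 < L → ∃ c : ℝ, 0 < c ∧ ∀ Ψ : TrialState N L,
      let Ψ₀ : Config N → ℂ := fun X => (boxN N L).indicator
        (fun X => ∏ i : Fin N, ∏ k : Fin 3, ((Real.sqrt (2 / L) * Real.sin (Real.pi * X i k / L) : ℝ) : ℂ)) X
      ENNReal.ofReal (3 * N * Real.pi ^ 2 / L ^ 2) +
          ENNReal.ofReal c * ∫⁻ X, (‖Ψ.ψ X - (∫ Y, (starRingEnd ℂ) (Ψ₀ Y) * Ψ.ψ Y) * Ψ₀ X‖₊ : ℝ≥0∞) ^ 2 ≤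
        energy 0 Ψ := by
  intro N L hN hL
  refine ⟨3 * Real.pi ^ 2 / L ^ 2, by positivity, fun Ψ => ?_⟩
  exact freeDirichletGap hN hL Ψ

end Summit.AtomisticToContinuum.BoseEinsteinCondensation.Cruxes.DyadicCoherenceDefect.Birth

end
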